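import Mathlib.FieldTheory.IsAlgClosed.AlgebraicClosure
import Mathlib.LinearAlgebra.Eigenspace.Charpoly
import Mathlib.LinearAlgebra.Eigenspace.Minpoly
import Mathlib.LinearAlgebra.Matrix.Charpoly.Minpoly
import Mathlib.LinearAlgebra.Charpoly.ToMatrix
import Mathlib.RingTheory.Polynomial.Cyclotomic.Basic
import Mathlib.FieldTheory.Separable
import Mathlib.FieldTheory.Minpoly.Field
import Mathlib.Data.ZMod.Basic
import HarnessLib

/-!
# Algebraic lemmas for Deligne–Serre 1974, §8.5–8.6

Elementary lemmas (all proved) used in the assembly of Deligne–Serre's Thm. 4.1 from its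
constituents (`Literature.NumberTheory.EllipticCurves.DeligneSerreWeightOneProofs`, in preparation):

* `Literature.NumberTheory.EllipticCurves.DeligneSerre1974.charpoly_eq_prod_of_pow_eq_one` — over a field containing a primitive
  `m`-th root of unity `ζ`, the characteristic polynomial of a matrix `M` with `M ^ m = 1` is a
  product of factors `X - ζ ^ i` ("les valeurs propres … sont des racines de l'unité", §8.6).
* `Literature.NumberTheory.EllipticCurves.DeligneSerre1974.injOn_rootsOfUnity_of_cast_ne_zero`,
  `Literature.NumberTheory.EllipticCurves.DeligneSerre1974.isPrimitiveRoot_map_of_cast_ne_zero` — a ring map from a domain to a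
  field in which `m ≠ 0` is injective on the `m`-th roots of unity and carries primitive `m`-th
  roots to primitive `m`-th roots (`X ^ m - 1` is separable in the target).
* `Literature.NumberTheory.EllipticCurves.DeligneSerre1974.exists_bound_forall_map_ne_zero` — a non-zero algebraic integer is killed
  by ring maps to rings of prime characteristic `ℓ` for only finitely many `ℓ` (those dividing the
  constant coefficient of its minimal polynomial).
* `Literature.NumberTheory.EllipticCurves.DeligneSerre1974.mem_of_forall_exists_map_eq` — if a polynomial `P` with algebraic-integer
  coefficients is congruent modulo infinitely many primes `ℓ` to a member of a fixed finite set `Y`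
  of such polynomials, then `P ∈ Y` (§8.5: "Comme `Y` est fini, il existe un `R` tel que la
  congruence … soit satisfaite pour une infinité de `ℓ`, et l'on a donc l'égalité").

## References

* P. Deligne, J.-P. Serre, *Formes modulaires de poids 1*, Ann. Sci. ÉNS (4) 7 (1974), §8.5–8.6.
-/

noncomputable section

open Polynomial

namespace Literature.NumberTheory.EllipticCurves.DeligneSerre1974

/-! ### Characteristic polynomials of matrices of finite order -/

section Charpoly

variable {F : Type*} [Field F] {n : Type*} [Fintype n] [DecidableEq n]

/-- Over an algebraically closed field, a root of the characteristic polynomial of `M` is a root of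
its minimal polynomial (both are the eigenvalues). [folklore] -/
lemma isRoot_minpoly_of_isRoot_charpoly {E : Type*} [Field E] (M : Matrix n n E) {μ : E}
    (h : M.charpoly.IsRoot μ) : (minpoly E M).IsRoot μ := by
  rw [← Matrix.charpoly_toLin'] at h
  rw [← Matrix.minpoly_toLin']
  exact Module.End.isRoot_of_hasEigenvalue
    ((Module.End.hasEigenvalue_iff_isRoot_charpoly _ μ).mpr h)

/-- If `M ^ m = 1` then every root of the characteristic polynomial of `M` is an `m`-th root of
unity. [folklore] -/
lemma pow_eq_one_of_isRoot_charpoly {E : Type*} [Field E] (M : Matrix n n E) {m : ℕ}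
    (hM : M ^ m = 1) {μ : E} (h : M.charpoly.IsRoot μ) : μ ^ m = 1 := by
  have hmin : minpoly E M ∣ X ^ m - 1 := minpoly.dvd E M (by simp [hM])
  have hroot : (X ^ m - 1 : E[X]).IsRoot μ := (isRoot_minpoly_of_isRoot_charpoly M h).dvd hmin
  simpa [sub_eq_zero] using hroot

/-- Auxiliary: a multiset of powers of `algebraMap F E ζ` gives a product of linear factors which is
the image of a product of factors `X - C (ζ ^ i)`. [folklore] -/
lemma exists_multiset_prod_eq_map {E : Type*} [Field E] [Algebra F E] (ζ : F)
    (r : Multiset E) (hr : ∀ μ ∈ r, ∃ i : ℕ, algebraMap F E ζ ^ i = μ) :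
    ∃ t : Multiset ℕ, (r.map fun μ ↦ X - C μ).prod =
      ((t.map fun i ↦ X - C (ζ ^ i)).prod).map (algebraMap F E) := by
  induction r using Multiset.induction_on with
  | empty => exact ⟨0, by simp⟩
  | cons μ r ih =>
    obtain ⟨t, ht⟩ := ih fun ν hν ↦ hr ν (Multiset.mem_cons_of_mem hν)
    obtain ⟨i, hi⟩ := hr μ (Multiset.mem_cons_self μ r)
    subst hi
    refine ⟨i ::ₘ t, ?_⟩
    simp only [Multiset.map_cons, Multiset.prod_cons, Polynomial.map_mul, Polynomial.map_sub,
      map_X, Polynomial.map_pow, map_C, map_pow, ht]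

/-- **Eigenvalues of a matrix of finite order.** Let `F` be a field containing a primitive `m`-th
root of unity `ζ` and `M` a square matrix over `F` with `M ^ m = 1`. Then the characteristic
polynomial of `M` is a product of linear factors `X - ζ ^ i` (its roots in an algebraic closure
are `m`-th roots of unity, all of which are powers of `ζ` and lie in `F`). [folklore] -/
theorem charpoly_eq_prod_of_pow_eq_one {m : ℕ} [NeZero m] {ζ : F} (hζ : IsPrimitiveRoot ζ m)
    (M : Matrix n n F) (hM : M ^ m = 1) :
    ∃ t : Multiset ℕ, M.charpoly = (t.map fun i ↦ X - C (ζ ^ i)).prod := by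
  let E := AlgebraicClosure F
  let ι : F →+* E := algebraMap F E
  have hι : Function.Injective ι := (algebraMap F E).injective
  let M' : Matrix n n E := M.map ι
  have hM' : M' ^ m = 1 := by
    have : M' = (RingHom.mapMatrix ι) M := rfl
    rw [this, ← map_pow, hM, map_one]
  have hchar : M'.charpoly = M.charpoly.map ι := Matrix.charpoly_map M ι
  have hsplit : M'.charpoly.Splits := IsAlgClosed.splits _
  have hprod := hsplit.eq_prod_roots_of_monic (Matrix.charpoly_monic M')
  have hζ' : IsPrimitiveRoot (ι ζ) m := hζ.map_of_injective hι
  obtain ⟨t, ht⟩ := exists_multiset_prod_eq_map (E := E) ζ M'.charpoly.roots fun μ hμ ↦ by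
    have hroot : M'.charpoly.IsRoot μ := (mem_roots (Matrix.charpoly_monic M').ne_zero).mp hμ
    obtain ⟨i, -, hi⟩ := hζ'.eq_pow_of_pow_eq_one (pow_eq_one_of_isRoot_charpoly M' hM' hroot)
    exact ⟨i, hi⟩
  refine ⟨t, Polynomial.map_injective ι hι ?_⟩
  rw [← hchar, hprod, ht]

/-- The `2 × 2` case of `charpoly_eq_prod_of_pow_eq_one`: the characteristic polynomial of a matrix
of order dividing `m` is `(X - ζ^i)(X - ζ^j)` for some `i, j < m`. [folklore] -/
theorem charpoly_eq_of_pow_eq_one_fin_two {m : ℕ} [NeZero m] {ζ : F} (hζ : IsPrimitiveRoot ζ m)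
    (M : Matrix (Fin 2) (Fin 2) F) (hM : M ^ m = 1) :
    ∃ i < m, ∃ j < m, M.charpoly = (X - C (ζ ^ i)) * (X - C (ζ ^ j)) := by
  obtain ⟨t, ht⟩ := charpoly_eq_prod_of_pow_eq_one hζ M hM
  have hcard : Multiset.card t = 2 := by
    have h1 := congrArg natDegree ht
    rw [Matrix.charpoly_natDegree_eq_dim, Fintype.card_fin, natDegree_multiset_prod_of_monic,
      Multiset.map_map] at h1
    · simp only [Function.comp_def, natDegree_X_sub_C, Multiset.map_const', Multiset.sum_replicate,
        smul_eq_mul, mul_one] at h1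
      exact h1.symm
    · intro f hf
      obtain ⟨i, -, rfl⟩ := Multiset.mem_map.mp hf
      exact monic_X_sub_C _
  obtain ⟨i, j, rfl⟩ := Multiset.card_eq_two.mp hcard
  have hpow : ∀ a : ℕ, ζ ^ a = ζ ^ (a % m) := fun a ↦ by
    conv_lhs => rw [← Nat.mod_add_div a m]
    rw [pow_add, pow_mul, hζ.pow_eq_one, one_pow, mul_one]
  refine ⟨i % m, Nat.mod_lt _ (NeZero.pos m), j % m, Nat.mod_lt _ (NeZero.pos m), ?_⟩
  rw [ht, ← hpow i, ← hpow j]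
  simp

end Charpoly

/-! ### Reduction of roots of unity -/

section RootsOfUnity

variable {R : Type*} [CommRing R] [IsDomain R] {k : Type*} [Field k]

/-- If `m ≠ 0` in the field `k`, a ring map `f : R → k` from a domain containing a primitive
`m`-th root of unity is injective on the `m`-th roots of unity of `R`
(`X ^ m - 1 = ∏ (X - f μ)` is separable in `k[X]`). [folklore] -/
theorem injOn_rootsOfUnity_of_cast_ne_zero {m : ℕ} (hm : (m : k) ≠ 0) {ζ : R}
    (hζ : IsPrimitiveRoot ζ m) (f : R →+* k) : Set.InjOn f {x : R | x ^ m = 1} := by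
  have hm0 : 0 < m := Nat.pos_of_ne_zero (by rintro rfl; exact hm (by simp))
  classical
  have hprod : (X ^ m - 1 : R[X]) = ∏ μ ∈ nthRootsFinset m (1 : R), (X - C μ) :=
    X_pow_sub_one_eq_prod hm0 hζ
  have hprodk : (X ^ m - 1 : k[X]) =
      (((nthRootsFinset m (1 : R)).val.map f).map fun a ↦ X - C a).prod := by
    have := congrArg (Polynomial.map f) hprod
    simp only [Polynomial.map_sub, Polynomial.map_pow, map_X, Polynomial.map_one,
      Polynomial.map_prod, map_C] at this
    rw [this, Finset.prod_eq_multiset_prod, Multiset.map_map]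
    rfl
  have hsep : (X ^ m - 1 : k[X]).Separable := by
    simpa using separable_X_pow_sub_C (1 : k) hm one_ne_zero
  have hnodup : (((nthRootsFinset m (1 : R)).val.map f)).Nodup := by
    have h := nodup_roots hsep
    rwa [hprodk, roots_multiset_prod_X_sub_C] at h
  intro x hx y hy hxy
  have hx' : x ∈ nthRootsFinset m (1 : R) := (mem_nthRootsFinset hm0 1).mpr hx
  have hy' : y ∈ nthRootsFinset m (1 : R) := (mem_nthRootsFinset hm0 1).mpr hy
  exact Multiset.inj_on_of_nodup_map hnodup x hx' y hy' hxy

/-- If `m ≠ 0` in the field `k`, a ring map `f : R → k` carries a primitive `m`-th root of unity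
of the domain `R` to a primitive `m`-th root of unity of `k`. [folklore] -/
theorem isPrimitiveRoot_map_of_cast_ne_zero {m : ℕ} (hm : (m : k) ≠ 0) {ζ : R}
    (hζ : IsPrimitiveRoot ζ m) (f : R →+* k) : IsPrimitiveRoot (f ζ) m := by
  have hm0 : 0 < m := Nat.pos_of_ne_zero (by rintro rfl; exact hm (by simp))
  have hinj := injOn_rootsOfUnity_of_cast_ne_zero hm hζ f
  refine IsPrimitiveRoot.mk_of_lt (f ζ) hm0 (by rw [← map_pow, hζ.pow_eq_one, map_one]) ?_
  intro l hl0 hlm hl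
  rw [← map_pow, ← f.map_one] at hl
  have h1 : ζ ^ l = 1 :=
    hinj (show (ζ ^ l) ^ m = 1 by rw [← pow_mul, mul_comm, pow_mul, hζ.pow_eq_one, one_pow])
      (show (1 : R) ^ m = 1 by simp) hl
  exact hζ.pow_ne_one_of_pos_of_lt hl0.ne' hlm h1

end RootsOfUnity

/-! ### Algebraic integers modulo infinitely many primes -/

section Integers

variable {R : Type*} [CommRing R] [IsDomain R]

/-- A non-zero algebraic integer `x` of a domain `R` is killed by ring maps `R → k` into rings of
prime characteristic `ℓ` only for `ℓ` below a bound depending on `x` (namely for `ℓ` dividing the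
non-zero constant coefficient of the minimal polynomial of `x` over `ℤ`). [folklore] -/
theorem exists_bound_forall_map_ne_zero {x : R} (hx : IsIntegral ℤ x) (hx0 : x ≠ 0) :
    ∃ N : ℕ, ∀ ℓ : ℕ, ℓ.Prime → N < ℓ →
      ∀ {k : Type*} [CommRing k] [CharP k ℓ] (f : R →+* k), f x ≠ 0 := by
  obtain ⟨p, hpmonic, hpx⟩ := hx
  obtain ⟨q, hpq, hq⟩ :=
    Polynomial.exists_eq_pow_rootMultiplicity_mul_and_not_dvd p hpmonic.ne_zero 0
  simp only [map_zero, sub_zero] at hpq hq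
  have hq0 : q.coeff 0 ≠ 0 := fun h ↦ hq (X_dvd_iff.mpr h)
  -- `q(x) = 0`, dividing `p(x) = 0` by the power of `x ≠ 0`
  have hqx : eval₂ (algebraMap ℤ R) x q = 0 := by
    rw [hpq, eval₂_mul, eval₂_X_pow] at hpx
    exact (mul_eq_zero.mp hpx).resolve_left (pow_ne_zero _ hx0)
  refine ⟨(q.coeff 0).natAbs, fun ℓ hℓ hNℓ k _ _ f hfx ↦ ?_⟩
  -- applying `f`: `q̄(f x) = q̄(0) = q(0) = 0` in `k`
  have h0 : ((q.coeff 0 : ℤ) : k) = 0 := by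
    have h1 := congrArg f hqx
    rw [hom_eval₂, hfx, eval₂_at_zero, map_zero, eq_intCast] at h1
    exact h1
  rw [CharP.intCast_eq_zero_iff k ℓ] at h0
  have hle : (ℓ : ℤ).natAbs ≤ (q.coeff 0).natAbs := Int.natAbs_le_of_dvd_ne_zero h0 hq0
  rw [Int.natAbs_natCast] at hle
  omega

/-- Finite-set version of `exists_bound_forall_map_ne_zero`: beyond a bound, no non-zero element
of the finite set `T` of algebraic integers is killed. [folklore] -/
theorem exists_bound_forall_map_ne_zero_finset [Algebra.IsIntegral ℤ R] (T : Finset R) :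
    ∃ N : ℕ, ∀ ℓ : ℕ, ℓ.Prime → N < ℓ →
      ∀ {k : Type*} [CommRing k] [CharP k ℓ] (f : R →+* k), ∀ x ∈ T, x ≠ 0 → f x ≠ 0 := by
  classical
  induction T using Finset.induction_on with
  | empty => exact ⟨0, by simp⟩
  | insert a T ha ih =>
    obtain ⟨N, hN⟩ := ih
    by_cases ha0 : a = 0
    · refine ⟨N, fun ℓ hℓ hNℓ k _ _ f x hx hx0 ↦ ?_⟩
      rcases Finset.mem_insert.mp hx with rfl | hx
      · exact absurd ha0 hx0
      · exact hN ℓ hℓ hNℓ f x hx hx0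
    · obtain ⟨N', hN'⟩ := exists_bound_forall_map_ne_zero (Algebra.IsIntegral.isIntegral a) ha0
      refine ⟨max N N', fun ℓ hℓ hNℓ k _ _ f x hx hx0 ↦ ?_⟩
      rcases Finset.mem_insert.mp hx with rfl | hx
      · exact hN' ℓ hℓ (lt_of_le_of_lt (le_max_right _ _) hNℓ) f
      · exact hN ℓ hℓ (lt_of_le_of_lt (le_max_left _ _) hNℓ) f x hx hx0

/-- Two algebraic integers congruent modulo infinitely many primes are equal: if `f_ℓ x = f_ℓ y`
for ring maps `f_ℓ : R → k_ℓ` into rings of characteristic `ℓ`, for infinitely many primes `ℓ`,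
then `x = y`. [folklore] -/
theorem eq_of_infinite_map_eq [Algebra.IsIntegral ℤ R] {x y : R} {L : Set ℕ} (hL : L.Infinite)
    (hLp : ∀ ℓ ∈ L, ℓ.Prime) (f : ∀ ℓ : ℕ, ℓ ∈ L → R →+* ZMod ℓ)
    (h : ∀ (ℓ : ℕ) (hℓ : ℓ ∈ L), f ℓ hℓ x = f ℓ hℓ y) : x = y := by
  by_contra hxy
  obtain ⟨N, hN⟩ := exists_bound_forall_map_ne_zero
    (Algebra.IsIntegral.isIntegral (R := ℤ) (x - y)) (sub_ne_zero.mpr hxy)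
  obtain ⟨ℓ, hℓL, hNℓ⟩ : ∃ ℓ ∈ L, N < ℓ := by
    by_contra! hcon
    exact hL (Set.Finite.subset (Set.finite_Iic N) fun ℓ hℓ ↦ hcon ℓ hℓ)
  exact hN ℓ (hLp ℓ hℓL) hNℓ (f ℓ hℓL) (by rw [map_sub, h ℓ hℓL, sub_self])

/-- Polynomial version of `eq_of_infinite_map_eq`. [folklore] -/
theorem polynomial_eq_of_infinite_map_eq [Algebra.IsIntegral ℤ R] {P Q : R[X]} {L : Set ℕ}
    (hL : L.Infinite) (hLp : ∀ ℓ ∈ L, ℓ.Prime) (f : ∀ ℓ : ℕ, ℓ ∈ L → R →+* ZMod ℓ)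
    (h : ∀ (ℓ : ℕ) (hℓ : ℓ ∈ L), P.map (f ℓ hℓ) = Q.map (f ℓ hℓ)) : P = Q := by
  ext i
  refine eq_of_infinite_map_eq hL hLp f fun ℓ hℓ ↦ ?_
  have := congrArg (fun p ↦ p.coeff i) (h ℓ hℓ)
  simpa only [coeff_map] using this

/-- **Deligne–Serre 1974, §8.5 (the pigeon-hole step).** Let `P` be a polynomial with
algebraic-integer coefficients and `Y` a finite set of such polynomials. If for infinitely many
primes `ℓ` the reduction of `P` under a ring map `f_ℓ : R → 𝔽_ℓ`-algebra `ZMod ℓ` coincides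
with the reduction of some member of `Y`, then `P ∈ Y` ("Comme `Y` est fini, il existe un `R` tel
que la congruence ci-dessus soit satisfaite pour une infinité de `ℓ`, et l'on a donc l'égalité").
[cite: DeligneSerreASENS1974, §8.5] -/
theorem mem_of_forall_exists_map_eq [Algebra.IsIntegral ℤ R] {P : R[X]} {Y : Finset R[X]}
    {L : Set ℕ} (hL : L.Infinite) (hLp : ∀ ℓ ∈ L, ℓ.Prime) (f : ∀ ℓ : ℕ, ℓ ∈ L → R →+* ZMod ℓ)
    (h : ∀ (ℓ : ℕ) (hℓ : ℓ ∈ L), ∃ Q ∈ Y, P.map (f ℓ hℓ) = Q.map (f ℓ hℓ)) : P ∈ Y := by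
  classical
  -- pigeon-hole: some `Q ∈ Y` works for infinitely many `ℓ ∈ L`
  have key : ∃ Q ∈ Y, {ℓ ∈ L | ∃ hℓ : ℓ ∈ L, P.map (f ℓ hℓ) = Q.map (f ℓ hℓ)}.Infinite := by
    by_contra! hcon
    apply hL
    have hsub : L ⊆ ⋃ Q ∈ Y, {ℓ ∈ L | ∃ hℓ : ℓ ∈ L, P.map (f ℓ hℓ) = Q.map (f ℓ hℓ)} := by
      intro ℓ hℓ
      obtain ⟨Q, hQY, hQ⟩ := h ℓ hℓ
      exact Set.mem_biUnion hQY ⟨hℓ, hℓ, hQ⟩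
    exact Set.Finite.subset (Set.Finite.biUnion Y.finite_toSet fun Q hQ ↦ hcon Q hQ) hsub
  obtain ⟨Q, hQY, hinf⟩ := key
  have hPQ : P = Q := by
    refine polynomial_eq_of_infinite_map_eq hinf (fun ℓ hℓ ↦ hLp ℓ hℓ.1)
      (fun ℓ hℓ ↦ f ℓ hℓ.1) fun ℓ hℓ ↦ ?_
    obtain ⟨hℓ', e⟩ := hℓ.2
    exact e
  exact hPQ ▸ hQY

end Integers

end Literature.NumberTheory.EllipticCurves.DeligneSerre1974
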